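import Literature.Topology.Euclidean.C1Covered
import Mathlib.Analysis.Convex.Basic
import HarnessLib

/-!
# Cone extension of a map on the unit sphere over the unit ball

Topic `Literature/Topology/Euclidean`. The elementary extension step of cellular approximation /
skeleton-wise extension arguments in a convex target (Hatcher, *Algebraic Topology* (2002), §4.1,
proof of Thm. 4.8: extend over a cell, then push off higher cells): a map `φ` defined on the unit
sphere of `Fin (n + 1) → ℝ` (sup norm) extends over the closed unit ball by coning from a point
`z`, `coneExt z φ w = z + ‖w‖ • (φ (‖w‖⁻¹ • w) - z)`. It is continuous on the closed ball when
`φ` is continuous on the sphere, takes values in any convex set containing `z` and `φ(sphere)`,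
and its image is `(n + 1)`-`C¹`-covered when `φ(sphere)` is `n`-`C¹`-covered
(`Literature.Topology.Euclidean.IsC1Covered.cone`).

* `coneExt`, `coneExt_of_mem_sphere`, `continuousOn_coneExt`, `coneExt_mem_of_convex`,
  `isC1Covered_image_coneExt`.

No `sorry`; [folklore].

## References

* A. Hatcher, *Algebraic Topology*, CUP (2002), §4.1, proof of Thm. 4.8; Lemma 4.7 (extension
  over cells). [HatcherAT2002]
-/

noncomputable section

open Set Metric Topology Function Filter

namespace Literature.Topology.Euclidean

variable {E : Type*} [NormedAddCommGroup E] [NormedSpace ℝ E] {n : ℕ}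

/-- **The cone extension** of `φ` (given on the unit sphere) from the apex `z`:
`w ↦ z + ‖w‖ • (φ (‖w‖⁻¹ • w) - z)` (at `w = 0` this is `z`). [folklore] -/
def coneExt (z : E) (φ : (Fin (n + 1) → ℝ) → E) (w : Fin (n + 1) → ℝ) : E :=
  z + ‖w‖ • (φ (‖w‖⁻¹ • w) - z)

/-- On the sphere the cone extension is `φ`. [folklore] -/
theorem coneExt_of_mem_sphere (z : E) (φ : (Fin (n + 1) → ℝ) → E) {w : Fin (n + 1) → ℝ}
    (hw : w ∈ sphere (0 : Fin (n + 1) → ℝ) 1) : coneExt z φ w = φ w := by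
  have h1 : ‖w‖ = 1 := mem_sphere_zero_iff_norm.1 hw
  simp [coneExt, h1]

/-- At the origin the cone extension is the apex. [folklore] -/
theorem coneExt_zero (z : E) (φ : (Fin (n + 1) → ℝ) → E) : coneExt z φ 0 = z := by
  simp [coneExt]

/-- Normalising a nonzero vector lands on the unit sphere. [folklore] -/
theorem inv_norm_smul_mem_sphere {w : Fin (n + 1) → ℝ} (hw : w ≠ 0) :
    ‖w‖⁻¹ • w ∈ sphere (0 : Fin (n + 1) → ℝ) 1 := by
  rw [mem_sphere_zero_iff_norm, norm_smul, norm_inv, norm_norm, inv_mul_cancel₀ (norm_ne_zero_iff.2 hw)]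

/-- **The cone extension is continuous on the closed ball** when `φ` is continuous on the
sphere. [folklore] -/
theorem continuousOn_coneExt (z : E) {φ : (Fin (n + 1) → ℝ) → E}
    (hφ : ContinuousOn φ (sphere 0 1)) : ContinuousOn (coneExt z φ) (closedBall 0 1) := by
  -- a bound for `φ` on the compact sphere
  obtain ⟨M, hM⟩ := (isCompact_sphere (0 : Fin (n + 1) → ℝ) 1).exists_bound_of_continuousOn hφ
  intro w hw
  by_cases hw0 : w = 0
  · -- at the apex: `‖coneExt w - z‖ ≤ ‖w‖ (M + ‖z‖)`
    subst hw0
    rw [ContinuousWithinAt, coneExt_zero]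
    have hb : ∀ w : Fin (n + 1) → ℝ, ‖coneExt z φ w - z‖ ≤ ‖w‖ * (M + ‖z‖) := by
      intro w
      by_cases h0 : w = 0
      · subst h0; simp [coneExt_zero]
      · have h1 := hM _ (inv_norm_smul_mem_sphere h0)
        calc ‖coneExt z φ w - z‖ = ‖w‖ * ‖φ (‖w‖⁻¹ • w) - z‖ := by
              simp only [coneExt, add_sub_cancel_left, norm_smul, Real.norm_eq_abs, abs_norm]
          _ ≤ ‖w‖ * (M + ‖z‖) := by
              refine mul_le_mul_of_nonneg_left ((norm_sub_le _ _).trans ?_) (norm_nonneg _)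
              linarith
    refine tendsto_nhdsWithin_of_tendsto_nhds ?_
    rw [tendsto_iff_norm_sub_tendsto_zero]
    refine squeeze_zero (fun w => norm_nonneg _) hb ?_
    have : Tendsto (fun w : Fin (n + 1) → ℝ => ‖w‖ * (M + ‖z‖)) (nhds 0) (nhds (‖(0 : Fin (n + 1) → ℝ)‖ * (M + ‖z‖))) :=
      (continuous_norm.mul continuous_const).tendsto 0
    simpa using this
  · -- off the apex: `φ ∘ (direction)` is continuous at `w` since `{0}ᶜ` is a neighbourhood
    have hdir : ContinuousAt (fun w : Fin (n + 1) → ℝ => ‖w‖⁻¹ • w) w :=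
      ((continuous_norm.continuousAt.inv₀ (norm_ne_zero_iff.2 hw0)).smul continuousAt_id)
    have hcomp : ContinuousWithinAt (φ ∘ fun v : Fin (n + 1) → ℝ => ‖v‖⁻¹ • v) {0}ᶜ w :=
      ContinuousWithinAt.comp (f := fun v : Fin (n + 1) → ℝ => ‖v‖⁻¹ • v)
        (hφ _ (inv_norm_smul_mem_sphere hw0)) hdir.continuousWithinAt
        fun v hv => inv_norm_smul_mem_sphere hv
    have hat : ContinuousAt (fun w : Fin (n + 1) → ℝ => φ (‖w‖⁻¹ • w)) w :=
      (continuousWithinAt_iff_continuousAt (isOpen_compl_singleton.mem_nhds hw0)).1 hcomp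
    have hcone : ContinuousAt (coneExt z φ) w := by
      unfold coneExt
      exact continuousAt_const.add (continuous_norm.continuousAt.smul (hat.sub continuousAt_const))
    exact hcone.continuousWithinAt

/-- **The cone extension stays in any convex set containing the apex and `φ(sphere)`.**
[folklore] -/
theorem coneExt_mem_of_convex {C : Set E} (hC : Convex ℝ C) {z : E} (hz : z ∈ C)
    {φ : (Fin (n + 1) → ℝ) → E} (hφ : MapsTo φ (sphere 0 1) C) {w : Fin (n + 1) → ℝ}
    (hw : w ∈ closedBall (0 : Fin (n + 1) → ℝ) 1) : coneExt z φ w ∈ C := by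
  by_cases hw0 : w = 0
  · subst hw0; rw [coneExt_zero]; exact hz
  · exact hC.add_smul_sub_mem hz (hφ (inv_norm_smul_mem_sphere hw0))
      ⟨norm_nonneg _, mem_closedBall_zero_iff.1 hw⟩

/-- **The image of the cone extension is `(n + 1)`-`C¹`-covered** when `φ(sphere)` is
`n`-`C¹`-covered (it lies in the cone over `φ(sphere)` together with the apex). [folklore] -/
theorem isC1Covered_image_coneExt (z : E) {φ : (Fin (n + 1) → ℝ) → E}
    (hφ : IsC1Covered n (φ '' sphere 0 1)) :
    IsC1Covered (n + 1) (coneExt z φ '' closedBall 0 1) := by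
  refine ((hφ.cone z).union (isC1Covered_singleton (n + 1) z)).mono ?_
  rintro _ ⟨w, hw, rfl⟩
  by_cases hw0 : w = 0
  · subst hw0; right; rw [coneExt_zero]; rfl
  · left
    exact ⟨(φ (‖w‖⁻¹ • w), ‖w‖), ⟨⟨‖w‖⁻¹ • w, inv_norm_smul_mem_sphere hw0, rfl⟩, mem_univ _⟩, rfl⟩

end Literature.Topology.Euclidean

end
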